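import Summits.AtomisticToContinuum.Crystallization.Theses.PalmUnimodularRigidity
import Summits.AtomisticToContinuum.Crystallization.Theorems.MinimiserShells.Negative.LoadBearing
import Summits.AtomisticToContinuum.Crystallization.Theorems.MinimiserShells.Negative.Rootedness
import Summits.AtomisticToContinuum.Crystallization.Theorems.PalmUnimodularRigidityMinimiserShellsEventTransfer
import Summits.AtomisticToContinuum.Crystallization.Theorems.PalmUnimodularRigidityMinimiserShellsEquilibriumInLaw
import Summits.AtomisticToContinuum.Crystallization.Theorems.PalmUnimodularRigidityMinimiserShellsEnergyFloor
import Summits.AtomisticToContinuum.Crystallization.Theorems.PalmUnimodularRigidityMinimiserShellsGoodShellMeasurable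
import Literature.Probability.Process.PointStationaryLaw
import Literature.MathematicalPhysics.StatisticalMechanics.RootEnergy
import Literature.MathematicalPhysics.StatisticalMechanics.MuGSC

/-!
# Stub `stub_pricingTransfer` (S8) of line `equilibrium-in-law-surgery` (reshape r3), crux `MinimiserShells`

Crux item stmt-AtomisticToContinuum-9225, crux decl
`Summit.AtomisticToContinuum.Crystallization.Theses.PalmUnimodularRigidity.MinimiserShells`.

**Theorem (`stub_pricingTransfer`).**  If, for every hard core `δ > 0`, there are `R₀, c > 0` such that
in every finite sub-window `C` of every `δ`-separated Sütő `μ`GSC `S` of Lennard-Jones at `μ = e*` the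
`R₀`-deep badly-shelled sites `G` are linearly priced,
`#C · e* + c · #G ≤ ½ ∑∑_C V_LJ` ("deep bad pricing", stub S7′ `stub_deepBadPricing`),
then `MinimiserShells` holds.

Proof.  By S1 (`…EquilibriumInLaw.stub_equilibriumInLaw`, fed with S2 = item 9229
`…EnergyFloor.stub_energyFloor`) a minimising point-stationary hard-core law is a.s. carried by
e*-`μ`GSCs; by S5 (`…GoodShellMeasurable.stub_goodShellMeasurable`) the bad-shell event is a measurable
set `Bᶜ` modulo the hard-core class; the event-transfer theorem
(`…EventTransfer.measure_event_eq_zero_of_deepPricing`: random grid, Mecke cell averaging, depth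
penalties) turns the deep pricing into `P(Bᶜ) = 0`.  No volume growth, no surface tension, no zero
density statement about individual configurations is needed — this replaces r2's open stub S3′.
The class-general form is `ae_goodShell_of_deepBadPricing`.
-/

noncomputable section

open MeasureTheory ProbabilityTheory
open scoped ENNReal BigOperators Classical

namespace Summit.AtomisticToContinuum.Crystallization.Theorems.PalmUnimodularRigidityMinimiserShells.PricingTransfer

open Literature.Probability.Process (IsPointStationaryLaw IsRootedHardCore count_restrict_singleton_ne_zero_iff
  map_sub_count_restrict)
open Literature.MathematicalPhysics.StatisticalMechanics (lennardJones IsMuGSC UniformlyDiscrete)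
open Summit.AtomisticToContinuum.Crystallization.Theses.PalmUnimodularRigidity (MinimiserShells UnimodularEnergyLowerBound)
open Summit.AtomisticToContinuum.Crystallization.Theorems.MinimiserShells.Negative.LoadBearing
  (eStar meanRootEnergy GoodShell minimiserShells_iff)
open Summit.AtomisticToContinuum.Crystallization.Theorems.MinimiserShells.Negative.Rootedness (E3
  countable_of_separated)
open Summit.AtomisticToContinuum.Crystallization.Theorems.PalmUnimodularRigidityMinimiserShells.EquilibriumInLaw.CellSums
  (sep_image_sub)
open Summit.AtomisticToContinuum.Crystallization.Theorems.PalmUnimodularRigidityMinimiserShells.EventTransfer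
  (measure_event_eq_zero_of_deepPricing)

/-- **Class-general shell transfer.**  Under a minimising point-stationary law on rooted `δ`-hard-core
configurations that is a.s. carried by a class `K`, deep linear pricing of badly-shelled sites on finite
sub-windows of `δ`-separated `K`-configurations forces the root shell to be a.s. good. -/
theorem ae_goodShell_of_deepBadPricing {δ : ℝ} (hδ : 0 < δ) {P : Measure (Measure E3)} [IsProbabilityMeasure P]
    (hcore : ∀ᵐ μ ∂P, IsRootedHardCore δ μ) (hstat : IsPointStationaryLaw P) (hE : meanRootEnergy P ≤ eStar)
    {K : Set E3 → Prop}
    (hK : ∀ᵐ μ ∂P, ∃ S : Set E3, μ = (Measure.count : Measure E3).restrict S ∧ K S)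
    {R₀ c : ℝ} (hR₀ : 0 < R₀) (hc : 0 < c)
    (hprice : ∀ S : Set E3, (∀ x ∈ S, ∀ z ∈ S, x ≠ z → δ ≤ dist x z) → K S →
      ∀ C : Finset E3, (↑C : Set E3) ⊆ S → ∀ G : Finset E3, G ⊆ C →
        (∀ y ∈ G, ¬ GoodShell ((Measure.count : Measure E3).restrict ((fun z => z - y) '' S)) ∧
          S ∩ Metric.closedBall y R₀ ⊆ ↑C) →
        (C.card : ℝ) * eStar + c * G.card ≤ (∑ x ∈ C, ∑ z ∈ C, lennardJones (dist x z)) / 2) :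
    ∀ᵐ μ ∂P, GoodShell μ := by
  obtain ⟨B, hBm, hB⟩ := GoodShellMeasurable.stub_goodShellMeasurable
  -- the bad-shell event `Bᶜ` is priced on deep sites, hence null
  have hnull : P Bᶜ = 0 := by
    refine measure_event_eq_zero_of_deepPricing hδ hcore hstat hE hK hBm.compl hR₀ hc ?_
    intro S hsep hKS C hCS G hGC hG
    refine hprice S hsep hKS C hCS G hGC fun y hy => ?_
    obtain ⟨hyB, hdeep⟩ := hG y hy
    refine ⟨fun hgood => hyB ?_, hdeep⟩
    -- `y ∈ S`, so the re-rooted configuration is a rooted `δ`-hard-core configuration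
    have hyS : y ∈ S := hCS (hGC hy)
    have hhc : IsRootedHardCore δ ((Measure.count : Measure E3).restrict ((fun z => z - y) '' S)) :=
      ⟨(fun z => z - y) '' S, ⟨y, hyS, sub_self y⟩, sep_image_sub hsep y, rfl⟩
    exact (hB δ hδ _ hhc).2 hgood
  have hae : ∀ᵐ μ ∂P, μ ∈ B := by
    rw [ae_iff]
    simpa only [Set.compl_def] using hnull
  filter_upwards [hcore, hae] with μ hμ hμB
  exact (hB δ hδ μ hμ).1 hμB

/-- **stub_pricingTransfer** (S8 of line `equilibrium-in-law-surgery`, reshape r3): deep linear pricing of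
badly-shelled sites in finite sub-windows of e*-`μ`GSCs (stub S7′) implies the crux `MinimiserShells`. -/
theorem stub_pricingTransfer :
    (∀ δ : ℝ, 0 < δ → ∃ R₀ c : ℝ, 0 < R₀ ∧ 0 < c ∧
      ∀ S : Set (EuclideanSpace ℝ (Fin 3)), (∀ x ∈ S, ∀ z ∈ S, x ≠ z → δ ≤ dist x z) →
        IsMuGSC lennardJones eStar S →
        ∀ C : Finset (EuclideanSpace ℝ (Fin 3)), (↑C : Set (EuclideanSpace ℝ (Fin 3))) ⊆ S →
        ∀ G : Finset (EuclideanSpace ℝ (Fin 3)), G ⊆ C →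
          (∀ y ∈ G, ¬ GoodShell ((Measure.count : Measure (EuclideanSpace ℝ (Fin 3))).restrict
              ((fun z => z - y) '' S)) ∧ S ∩ Metric.closedBall y R₀ ⊆ ↑C) →
          (C.card : ℝ) * eStar + c * G.card ≤ (∑ x ∈ C, ∑ z ∈ C, lennardJones (dist x z)) / 2) →
    MinimiserShells := by
  intro hprice
  rw [minimiserShells_iff]
  intro δ hδ P hP hcore hstat hE
  obtain ⟨R₀, c, hR₀, hc, hpr⟩ := hprice δ hδ
  have hK : ∀ᵐ μ ∂P, ∃ S : Set E3, μ = (Measure.count : Measure E3).restrict S ∧ IsMuGSC lennardJones eStar S :=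
    EquilibriumInLaw.stub_equilibriumInLaw EnergyFloor.stub_energyFloor δ hδ P hP hcore hstat hE
  exact ae_goodShell_of_deepBadPricing hδ hcore hstat hE hK hR₀ hc hpr

end Summit.AtomisticToContinuum.Crystallization.Theorems.PalmUnimodularRigidityMinimiserShells.PricingTransfer

end
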